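import Summits.HodgeConjecture.HodgeConjecture.Theorems.VHCAbelianSchemesRoadSecantAnchorInhabitedDefs
import Summits.HodgeConjecture.HodgeConjecture.Theorems.VHCAbelianSchemesRoadPencilThrough
import Summits.HodgeConjecture.HodgeConjecture.Theorems.VHCAbelianSchemesRoadSecantAnchor
import Literature.AlgebraicGeometry.HodgeTheory.AlgebraicClassesCupAbelianVarietyDiagonal
import HarnessLib

/-!
# Road b02 (`VHCAbelianSchemesRoad`) — THE SECANT-ANCHOR DATA ARE INHABITED AT PENCIL LEVEL: the served-fibre predicate of the `(6, 3)` cut is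
# satisfiable with every binder of the cell (modulo the preprint), and inside regime 2 (modulo the preprint and ONE displayed family-supply hypothesis)

research route conditional on HC_CM; not a corollary; Q11.4-sentence-2 already refuted in dim ≥ 3.

ring2-b03 gen 76, on director-hodge g7's item (2) (HOME INBOX 2026-08-27T04:21:07Z) as governed by ring2 LEAD gen 151's rulings (04:39:58Z (2)/(3):
«type THE PAIR»; vehicle correction 04:30:53Z; F2/F5). FACT-FREE except for the displayed hypotheses; `HC_CM` nowhere. The anchor data are
ring2-b02's OUTPUT-level `secantAnchorSixfold C X` / `secantServedClasses C X θ` (`VHCAbelianSchemesRoadSecantAnchorDefs`, L2) — `(X, θ)` carries a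
PINNED datum of the crux's twisted door `twistedReflexiveClass C AdmTw` at `(6, 3)` with `κ₃` off `ℂ·θ³`; served = the planes `ℂ·θ³ + ℂ·κ₃` —;
the preprint input is ring2-b02's L1 `[claim] Markman2025_secantQuotientAnchor_twistedCarrier_sixfold C AdmTw` (arXiv:2502.03415, UNREFEREED):
for every even `d ≥ 4` a secant-quotient anchor `(Y_d, h)` with a rational `γ ∉ ℂ·h³` pulling back to a Weil class, and the pinned datum ON
EVERY COPY of `Y_d` (`HasSecantCarrierWeilAnchor C AdmTw d`) — the every-copy clause makes everything below TRANSPORT-FREE (no `htr`, no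
iso-invariance of the door).

* §1 TOOLBOX. `mem_algebraicClasses_of_twistedReflexiveClass` — on an abelian variety every class `κ_p`, `p ∈ I`, of a datum of the twisted
  door is ALGEBRAIC (`κ_p = Σ (1/i!) B₀ⁱ ∪ ch_{p-i}(E•)`: `B₀` algebraic, Chern characters of vector-bundle complexes algebraic, cup products of
  algebraic classes algebraic on an abelian variety); `not_mem_span_cupPowTwo_map_add_smul` — `γ ∉ ℂ·h³ ⟹ e^*γ + c·(e^*h)³ ∉ ℂ·(e^*h)³` along
  `e : X' ≅ X`; `secantAnchor_mem_of_copyDatum` — the every-copy datum at a copy `e : X' ≅ Y.X` makes `e^*h` a secant-anchor class of `X'` serving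
  the plane `ℂ·(e^*h)³ + ℂ·e^*γ` (ring2-b02's `mem_carrierAnchorClassesAt_of_datum` / `span_le_carrierServedClassesAt_of_datum`);
  `exists_anchor_of_hasSecantCarrierWeilAnchor` — the anchor `(Y, h, γ)` with `γ` rational AND ALGEBRAIC (from the datum on the identity copy).
* §2 THE FACT-FREE HALF OF THE PAIR (modulo the preprint only). `exists_servedConstantPencil_of_hasSecantCarrierWeilAnchor`: the constant pencil
  `Y × 𝔸¹ ⟶ 𝔸¹` through the anchor satisfies EVERY binder of the cell `(6, 3)` (PART Z-c), carries `W := pr₁^*γ` fibrewise rational `(3,3)` and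
  algebraic at the origin, AND is SERVED at the origin by `Θ := pr₁^*h` — `HasServedFibre 6 3 (secant anchors) (secant served)` holds on a pencil
  of the cell's shape; hence `not_forall_not_hasServedFibre_63_secant_of_markman : [claim] → ¬ ∀ f W, ¬ HasServedFibre …` — the hypothesis of
  PART AA's `under_not_iff_of_forall_not` FAILS, so `Residual63 C` is not the rung «by emptiness». What this half does NOT give: the regime-2
  clause «`W` not algebraic-Lefschetz on every fibre» — at the anchor every Hodge class is Lefschetz (F2), so the constant pencil is outside regime 2.
* §3 THE CONDITIONAL HALF (modulo the preprint AND the displayed `SecantAnchorWeilPencilSupply`).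
  `exists_servedPencil_regimeTwo_of_hasSecantCarrierWeilAnchor_of_supply`: an exceptional cell-shaped pencil through `(Y_d, h)` carrying `γ`
  (the supply) is a pencil of the cell IN REGIME 2 (algebraic at the anchor fibre, exceptional elsewhere) WITH a served fibre (the anchor fibre, by the
  every-copy clause); hence `not_forall_not_hasServedFibre_63_secant_regimeTwo_of_markman_of_supply` (the `¬ ∀`-form PART AA-c/AA-d ask for, with the
  smooth-projective / abelian-fibres / somewhere-exceptional binders) and the full-binder form. These are the tribunal's pencil-level C2 words for the
  line card: «partition NON-VACUOUS inside the cell's binders modulo the preprint and one displayed family-supply hypothesis; satisfiable with every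
  binder but regime 2 modulo the preprint alone».

What is NOT claimed: `SecantAnchorWeilPencilSupply`, the preprint fact, any carrier / residual / cell / K-SR♭∃ / VHC / `HC_AV` / HC.
References: [cite: Markman2025SecantWeil, Thm. 1.4.1, Cor. 1.3.2, Cor. 4.0.4 and §1.5] [cite: vanGeemen1994HodgeAV, §2.4, Thm. 4.11 and 5.3–5.5]
[cite: Bloch1972Semiregularity, Remark (7.5)] [cite: Fulton1998, §15.1 and Prop. 19.1.2] [cite: Hartshorne1977, II.3 (p. 89) and II Ex. 4.9]
[cite: VoisinHodgeI2002, Thm. 7.10, Thm. 11.30 and §7.1.2].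
-/

noncomputable section

open CategoryTheory CategoryTheory.Limits AlgebraicGeometry Topology MonoidalCategory CartesianMonoidalCategory

-- the cell's namespace repeats the summit name (`Summit.HodgeConjecture.HodgeConjecture…`), as in every `Ring2*` file
set_option linter.dupNamespace false

namespace Summit.HodgeConjecture.HodgeConjecture.Ring2.SemiregularRepresentatives

open Literature.AlgebraicGeometry Literature.AlgebraicGeometry.Motives
open Literature.AlgebraicGeometry.HodgeTheory
open Literature.AlgebraicTopology.SingularHomology
open Literature.Barriers.HodgeConjecture (divisorClassesSpan)
open Summit.Ventures.HSemireg (ObjClass)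

/-! ## §1 Toolbox -/

section Toolbox

variable {C : ChernCharacterBetti} {Adm : PerfectAdmissibility} {n : ℕ}

/-- **On an abelian variety every class of a twisted-door datum is ALGEBRAIC**: `κ_p = (exp(B₀) ∪ ch(E•))_p = Σᵢ (1/i!) B₀ⁱ ∪ ch_{p-i}(E•)`
with `B₀ ∈ N¹H²` (so every `B₀ⁱ` is algebraic), `ch_j(E•)` algebraic for a bounded complex of vector bundles on a smooth projective variety, and
cup products of algebraic classes algebraic on an abelian variety. [cite: Fulton1998, §15.1 and Prop. 19.1.2]
[cite: Perry2026Semiregularity, Thm. 1.1 (hypotheses)] [cite: VoisinHodgeII2003, §9.2.4 Prop. 9.20] -/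
theorem mem_algebraicClasses_of_twistedReflexiveClass (A : AbelianVariety ℂ) {I : Finset ℕ}
    {κ : (q : ℕ) → complexBetti A.X (2 * q)} (h : twistedReflexiveClass C Adm n A.X I κ) {p : ℕ} (hp : p ∈ I) :
    κ p ∈ algebraicClasses A.X p := by
  have hA : IsSmoothProjective A.dim A.X := AbelianVariety.isSmoothProjective_holds (A := A)
  obtain ⟨E, hE, B₀, -, -, hBalg, hκ⟩ := h
  rw [hκ p hp]
  unfold expTwistClasses
  refine Submodule.sum_mem _ fun i _ ↦ Submodule.smul_mem _ _ ?_
  exact AbelianVariety.cupProduct_mem_algebraicClasses' A _ (cupPowTwo_mem_algebraicClasses_of_mem hA hBalg i)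
    (chPerfect_mem_algebraicClasses C A.X hA E hE.isFiniteLocallyFree (p - i))

/-- **`γ ∉ ℂ·hᵖ ⟹ e^*γ + c·(e^*h)ᵖ ∉ ℂ·(e^*h)ᵖ`** along an isomorphism `e : X' ≅ X` (`(e^*h)ᵖ = e^*(hᵖ)`, `e^*` injective and linear).
[folklore] [cite: HatcherAT2002, Prop. 3.10] -/
theorem not_mem_span_cupPowTwo_map_add_smul {X X' : SchemeOver ℂ} (e : X' ≅ X) {p : ℕ} {h : complexBetti X 2}
    {γ : complexBetti X (2 * p)} (hγ : γ ∉ (ℂ ∙ cupPowTwo h p)) (c : ℂ) :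
    complexBetti.map e.hom (2 * p) γ + c • cupPowTwo (complexBetti.map e.hom 2 h) p ∉
      (ℂ ∙ cupPowTwo (complexBetti.map e.hom 2 h) p) := by
  intro hmem
  apply hγ
  have hpow : cupPowTwo (complexBetti.map e.hom 2 h) p = complexBetti.map e.hom (2 * p) (cupPowTwo h p) :=
    (map_cupPowTwo _ h p).symm
  rw [hpow] at hmem
  have hγ' : complexBetti.map e.hom (2 * p) γ ∈ (ℂ ∙ complexBetti.map e.hom (2 * p) (cupPowTwo h p)) := by
    have hsub := Submodule.sub_mem _ hmem (Submodule.smul_mem _ c (Submodule.mem_span_singleton_self _))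
    rwa [add_sub_cancel_right] at hsub
  obtain ⟨a, ha⟩ := Submodule.mem_span_singleton.1 hγ'
  have hback := congrArg (complexBetti.map e.inv (2 * p)) ha
  rw [map_smul, e.complexBetti_map_inv_map_hom, e.complexBetti_map_inv_map_hom] at hback
  exact Submodule.mem_span_singleton.2 ⟨a, hback⟩

/-- **The every-copy datum makes the copy an anchor serving the plane `ℂ·(e^*h)³ + ℂ·e^*γ`.** At a copy `e : X' ≅ Y` of the secant-quotient
anchor, a pinned datum `(I ∋ 3, κ)` of the crux's twisted door with `κ₃ = e^*γ + c₃·(e^*h)³`, `κ_k = c_k·(e^*h)^k` (`k ≠ 3`) and `γ ∉ ℂ·h³` gives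
`e^*h ∈ secantAnchorSixfold C X'` and `ℂ·(e^*h)³ + ℂ·e^*γ ⊆ secantServedClasses C X' (e^*h)` (ring2-b02's membership lemmas; `κ₃` is off the ray by
`not_mem_span_cupPowTwo_map_add_smul`, and `e^*γ = κ₃ - c₃·(e^*h)³` lies on the served plane). [cite: Markman2025SecantWeil, Thm. 1.4.1 (4th item) and §1.5]
[cite: Bloch1972Semiregularity, Remark (7.5)] -/
theorem secantAnchor_mem_of_copyDatum {X X' : SchemeOver ℂ} (e : X' ≅ X) {h : complexBetti X 2} {γ : complexBetti X (2 * 3)}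
    (hγ : γ ∉ (ℂ ∙ cupPowTwo h 3)) {I : Finset ℕ} {κ : (k : ℕ) → complexBetti X' (2 * k)} {c : ℕ → ℂ} (h3 : 3 ∈ I)
    (hκ : twistedReflexiveClass C (fun n X₀ I E => Summit.Ventures.HSemireg.gluableSigmaAdmissible n X₀ I E ∨
      Literature.AlgebraicGeometry.HodgeTheory.bfSingleAdmissible n X₀ I E) 6 X' I κ)
    (hκ3 : κ 3 = complexBetti.map e.hom (2 * 3) γ + c 3 • cupPowTwo (complexBetti.map e.hom 2 h) 3)
    (hκk : ∀ k ∈ I, k ≠ 3 → κ k = c k • cupPowTwo (complexBetti.map e.hom 2 h) k) :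
    complexBetti.map e.hom 2 h ∈ secantAnchorSixfold C X' ∧
      complexBetti.map e.hom (2 * 3) γ ∈ secantServedClasses C X' (complexBetti.map e.hom 2 h) := by
  have hoff : κ 3 ∉ (ℂ ∙ cupPowTwo (complexBetti.map e.hom 2 h) 3) := by
    rw [hκ3]
    exact not_mem_span_cupPowTwo_map_add_smul e hγ (c 3)
  refine ⟨mem_carrierAnchorClassesAt_of_datum h3 hκ hoff hκk, span_le_carrierServedClassesAt_of_datum h3 hκ hoff hκk ?_⟩
  have hγeq : complexBetti.map e.hom (2 * 3) γ = κ 3 - c 3 • cupPowTwo (complexBetti.map e.hom 2 h) 3 := by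
    rw [hκ3, add_sub_cancel_right]
  rw [SetLike.mem_coe, hγeq]
  exact Submodule.sub_mem _ (Submodule.subset_span (Set.mem_insert_of_mem _ (Set.mem_singleton _)))
    (Submodule.smul_mem _ _ (Submodule.subset_span (Set.mem_insert _ _)))

/-- **The anchor of the preprint fact, unpacked with what the pencils need**: an abelian sixfold `Y` with a polarisation class `h` and a class `γ`
that is rational, ALGEBRAIC (from the datum on the identity copy: `γ = κ₃ - c₃·h³`, §1) and off `ℂ·h³`, the Weil data `(P, ψ₀, q)` of the
statement, and the every-copy datum. [cite: Markman2025SecantWeil, Thm. 1.4.1, Cor. 4.0.4 and §1.5] [cite: Fulton1998, Prop. 19.1.2] -/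
theorem exists_anchor_of_hasSecantCarrierWeilAnchor {d : ℕ}
    (hd : HasSecantCarrierWeilAnchor C (fun n X₀ I E => Summit.Ventures.HSemireg.gluableSigmaAdmissible n X₀ I E ∨
      Literature.AlgebraicGeometry.HodgeTheory.bfSingleAdmissible n X₀ I E) d) :
    ∃ (P Y : AbelianVariety ℂ) (ψ₀ : P ⟶ P) (q : P ⟶ Y) (h : complexBetti Y.X 2) (γ : complexBetti Y.X (2 * 3)),
      P.dim = 6 ∧ Y.dim = 6 ∧ ψ₀ ≫ ψ₀ = -(d • 𝟙 P) ∧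
      (∀ k : ℕ, Function.Bijective (complexBetti.map q.hom.hom.hom k)) ∧
      IsPolarizationClass 6 Y.X h ∧
      IsHyperbolicWeilType P ψ₀ 3 (complexBetti.map q.hom.hom.hom 2 h) ∧
      IsRationalClass γ ∧ γ ∈ algebraicClasses Y.X 3 ∧ γ ∉ (ℂ ∙ cupPowTwo h 3) ∧
      complexBetti.map q.hom.hom.hom (2 * 3) γ ∈ weilClassesOf P ψ₀ 3 d ∧
      ∀ (X' : SchemeOver ℂ) (e : X' ≅ Y.X),
        complexBetti.map e.hom 2 h ∈ secantAnchorSixfold C X' ∧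
          complexBetti.map e.hom (2 * 3) γ ∈ secantServedClasses C X' (complexBetti.map e.hom 2 h) := by
  obtain ⟨P, Y, ψ₀, q, h, γ, hP, hY, hψ, hq, hpol, hhyp, hγQ, hγoff, hγW, hcopy⟩ := hd
  have hYsp : IsSmoothProjective Y.dim Y.X := AbelianVariety.isSmoothProjective_holds (A := Y)
  refine ⟨P, Y, ψ₀, q, h, γ, hP, hY, hψ, hq, hpol, hhyp, hγQ, ?_, hγoff, hγW, fun X' e ↦ ?_⟩
  · -- algebraicity of `γ` from the datum on the identity copy
    obtain ⟨I, κ, c, h3, hκ, hκ3, -⟩ := hcopy Y.X (Iso.refl Y.X)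
    have hid2 : complexBetti.map (Iso.refl Y.X).hom 2 h = h := by
      rw [Iso.refl_hom, complexBetti.map_id]; rfl
    have hid6 : complexBetti.map (Iso.refl Y.X).hom (2 * 3) γ = γ := by
      rw [Iso.refl_hom, complexBetti.map_id]; rfl
    rw [hid2, hid6] at hκ3
    have hκalg : κ 3 ∈ algebraicClasses Y.X 3 := mem_algebraicClasses_of_twistedReflexiveClass Y hκ h3
    have hh3 : cupPowTwo h 3 ∈ algebraicClasses Y.X 3 :=
      cupPowTwo_mem_algebraicClasses_of_mem hYsp (hY ▸ hpol).mem_algebraicClasses 3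
    have hγeq : γ = κ 3 - c 3 • cupPowTwo h 3 := by rw [hκ3, add_sub_cancel_right]
    rw [hγeq]
    exact Submodule.sub_mem _ hκalg (Submodule.smul_mem _ _ hh3)
  · obtain ⟨I, κ, c, h3, hκ, hκ3, hκk⟩ := hcopy X' e
    exact secantAnchor_mem_of_copyDatum e hγoff h3 hκ hκ3 hκk

end Toolbox

/-! ## §2 The fact-free half: the served-fibre predicate is satisfiable with every binder of the cell (constant pencil through the anchor) -/

section ConstantPencil

variable {C : ChernCharacterBetti}

/-- **THE SECANT-ANCHOR DATA ARE SERVED ON A PENCIL OF THE CELL'S SHAPE** (modulo the preprint only; transport-free). From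
`HasSecantCarrierWeilAnchor C AdmTw d`: the constant pencil `pr₂ : Y × 𝔸¹ ⟶ 𝔸¹` through the anchor satisfies EVERY binder of the cell `(6, 3)`
of K-SR♭∃ (smooth projective of relative dimension `6`, quasi-projective total space, smooth irreducible affine base of Krull dimension one,
abelian fibres, a section), `W := pr₁^*γ` is fibrewise rational `(3,3)` and algebraic at the origin, AND the pencil HAS A SERVED FIBRE for
`(secantAnchorSixfold C, secantServedClasses C)`: the origin, polarised by `Θ := pr₁^*h`, by the every-copy clause at the copy
`(Y × 𝔸¹)_{s₀} ≅ Y`. The regime-2 clause is NOT asserted (at the anchor every Hodge class is Lefschetz, finding F2).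
[cite: Hartshorne1977, II.3 (p. 89) and II Ex. 4.9] [cite: Markman2025SecantWeil, Thm. 1.4.1 and §1.5] [cite: VoisinHodgeI2002, §7.1.2] -/
theorem exists_servedConstantPencil_of_hasSecantCarrierWeilAnchor {d : ℕ}
    (hd : HasSecantCarrierWeilAnchor C (fun n X₀ I E => Summit.Ventures.HSemireg.gluableSigmaAdmissible n X₀ I E ∨
      Literature.AlgebraicGeometry.HodgeTheory.bfSingleAdmissible n X₀ I E) d) :
    ∃ (𝒳 S : SchemeOver ℂ) (f : 𝒳 ⟶ S) (W : complexBetti 𝒳 (2 * 3)) (s₀ : ComplexPoints S),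
      IsSmoothProjectiveFamily f 6 ∧ IsQuasiProjectiveOver 𝒳 ∧ IrreducibleSpace S.left ∧ IsAffine S.left ∧
      AlgebraicGeometry.Smooth S.hom ∧ topologicalKrullDim S.left = 1 ∧
      (∀ s : ComplexPoints S, ∃ A' : AbelianVariety ℂ, A'.dim = 6 ∧ Nonempty (A'.X ≅ fiberOver f s)) ∧
      (∃ e : S ⟶ 𝒳, e ≫ f = 𝟙 S) ∧
      (∀ s : ComplexPoints S, IsRationalClass (complexBetti.map (fiberι f s) (2 * 3) W) ∧
        IsOfHodgeType 6 (fiberOver f s) (2 * 3) 3 3 (complexBetti.map (fiberι f s) (2 * 3) W)) ∧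
      complexBetti.map (fiberι f s₀) (2 * 3) W ∈ algebraicClasses (fiberOver f s₀) 3 ∧
      HasServedFibre 6 3 (fun X θ => θ ∈ secantAnchorSixfold C X) (secantServedClasses C) f W := by
  obtain ⟨P, Y, ψ₀, q, h, γ, -, hY, -, -, hpol, -, hγQ, hγalg, hγoff, -, hcopy⟩ := exists_anchor_of_hasSecantCarrierWeilAnchor hd
  have hYsp' : IsSmoothProjective Y.dim Y.X := AbelianVariety.isSmoothProjective_holds (A := Y)
  have hYsp : IsSmoothProjective 6 Y.X := hY ▸ hYsp'
  have hpol6 : IsPolarizationClass 6 Y.X h := hpol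
  have hγH : IsOfHodgeType 6 Y.X (2 * 3) 3 3 γ := isOfHodgeType_of_mem_algebraicClasses_of_isSmoothProjective hYsp 3 hγalg
  have hhQ : IsRationalClass h := hpol6.isRationalClass
  have hhH : IsOfHodgeType 6 Y.X 2 1 1 h := isOfHodgeType_of_mem_algebraicClasses_of_isSmoothProjective hYsp 1 hpol6.mem_algebraicClasses
  haveI : IrreducibleSpace (specOver ℂ (MvPolynomial (Fin 1) ℂ)).left := irreducibleSpace_affineLine_left
  haveI : IsAffine (specOver ℂ (MvPolynomial (Fin 1) ℂ)).left := isAffine_affineLine_left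
  obtain ⟨s₀⟩ := nonempty_complexPoints_affineLine
  have hf : IsSmoothProjectiveFamily (snd Y.X (specOver ℂ (MvPolynomial (Fin 1) ℂ))) 6 := isSmoothProjectiveFamily_snd hYsp _
  have h𝒳 : IsQuasiProjectiveOver (Y.X ⊗ specOver ℂ (MvPolynomial (Fin 1) ℂ)) :=
    isQuasiProjectiveOver_tensor_of_isProjectiveOver hYsp.isProjectiveOver isQuasiProjectiveOver_affineLine
  have habel : ∀ s : ComplexPoints (specOver ℂ (MvPolynomial (Fin 1) ℂ)),
      ∃ A' : AbelianVariety ℂ, A'.dim = 6 ∧ Nonempty (A'.X ≅ fiberOver (snd Y.X (specOver ℂ (MvPolynomial (Fin 1) ℂ))) s) :=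
    fun s ↦ ⟨Y, hY, ⟨sliceFiberIso Y.X s⟩⟩
  have hres := fun s : ComplexPoints (specOver ℂ (MvPolynomial (Fin 1) ℂ)) ↦ map_fiberι_map_fst_eq s (2 * 3) γ
  have hresθ := fun s : ComplexPoints (specOver ℂ (MvPolynomial (Fin 1) ℂ)) ↦ map_fiberι_map_fst_eq s 2 h
  refine ⟨_, _, snd Y.X (specOver ℂ (MvPolynomial (Fin 1) ℂ)), complexBetti.map (fst Y.X _) (2 * 3) γ, s₀, hf, h𝒳,
    irreducibleSpace_affineLine_left, isAffine_affineLine_left, smooth_affineLine_hom, topologicalKrullDim_affineLine_left, habel,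
    exists_section_snd Y (Iso.refl Y.X) _, fun s ↦ ?_, ?_, ?_⟩
  · rw [hres s]
    exact ⟨(isRationalClass_map_iff_of_iso (sliceFiberIso Y.X s).symm).2 hγQ,
      (isOfHodgeType_map_iff_of_iso (sliceFiberIso Y.X s).symm).2 hγH⟩
  · rw [hres s₀]
    exact (mem_algebraicClasses_map_iff_of_iso (sliceFiberIso Y.X s₀).symm).2 hγalg
  · refine ⟨s₀, complexBetti.map (fst Y.X _) 2 h, fun s ↦ ?_, fun s ↦ ?_, ?_, ?_⟩
    · rw [hresθ s]
      exact (isRationalClass_map_iff_of_iso (sliceFiberIso Y.X s).symm).2 hhQ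
    · rw [hresθ s]
      exact (isOfHodgeType_map_iff_of_iso (sliceFiberIso Y.X s).symm).2 hhH
    · rw [hresθ s₀]
      exact (hcopy _ (sliceFiberIso Y.X s₀).symm).1
    · rw [hresθ s₀, hres s₀]
      exact (hcopy _ (sliceFiberIso Y.X s₀).symm).2

/-- **Hence, modulo the preprint alone, the hypothesis of PART AA's `under_not_iff_of_forall_not` FAILS for the secant data**: it is NOT the case
that no pencil has a served fibre — `Residual63 C` is not the rung «by emptiness of the anchor set» (the tribunal's first C2 reading).
[cite: Markman2025SecantWeil, Thm. 1.4.1 and §1.5] [cite: Bloch1972Semiregularity, Remark (7.5)] -/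
theorem not_forall_not_hasServedFibre_63_secant_of_markman
    (hM : Markman2025_secantQuotientAnchor_twistedCarrier_sixfold C
      (fun n X₀ I E => Summit.Ventures.HSemireg.gluableSigmaAdmissible n X₀ I E ∨
        Literature.AlgebraicGeometry.HodgeTheory.bfSingleAdmissible n X₀ I E)) :
    ¬ ∀ ⦃𝒳 S : SchemeOver ℂ⦄ (f : 𝒳 ⟶ S) (W : complexBetti 𝒳 (2 * 3)),
      ¬ HasServedFibre 6 3 (fun X θ => θ ∈ secantAnchorSixfold C X) (secantServedClasses C) f W := by
  intro hnone
  obtain ⟨𝒳, S, f, W, -, -, -, -, -, -, -, -, -, -, -, hserved⟩ :=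
    exists_servedConstantPencil_of_hasSecantCarrierWeilAnchor (hM 4 (by decide) le_rfl)
  exact hnone f W hserved

/-- **The same with every binder of the cell displayed** (everything except the regime-2 clause): modulo the preprint, some pencil satisfying
every binder of `LefAtExceptionalRegimeAt _ 6 3`, with `W` fibrewise rational `(3,3)` and algebraic at some fibre, HAS a served fibre.
[cite: Markman2025SecantWeil, Thm. 1.4.1 and §1.5] [cite: Hartshorne1977, II.3 (p. 89)] -/
theorem not_forall_cellBinders_not_hasServedFibre_63_secant_of_markman
    (hM : Markman2025_secantQuotientAnchor_twistedCarrier_sixfold C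
      (fun n X₀ I E => Summit.Ventures.HSemireg.gluableSigmaAdmissible n X₀ I E ∨
        Literature.AlgebraicGeometry.HodgeTheory.bfSingleAdmissible n X₀ I E)) :
    ¬ ∀ ⦃𝒳 S : SchemeOver ℂ⦄ (f : 𝒳 ⟶ S), IsSmoothProjectiveFamily f 6 → IsQuasiProjectiveOver 𝒳 →
      IrreducibleSpace S.left → IsAffine S.left → AlgebraicGeometry.Smooth S.hom → topologicalKrullDim S.left = 1 →
      (∀ s : ComplexPoints S, ∃ A' : AbelianVariety ℂ, A'.dim = 6 ∧ Nonempty (A'.X ≅ fiberOver f s)) →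
      (∃ e : S ⟶ 𝒳, e ≫ f = 𝟙 S) →
      ∀ (W : complexBetti 𝒳 (2 * 3)),
        (∀ s : ComplexPoints S, IsRationalClass (complexBetti.map (fiberι f s) (2 * 3) W) ∧
          IsOfHodgeType 6 (fiberOver f s) (2 * 3) 3 3 (complexBetti.map (fiberι f s) (2 * 3) W)) →
        ∀ s₀ : ComplexPoints S,
          complexBetti.map (fiberι f s₀) (2 * 3) W ∈ algebraicClasses (fiberOver f s₀) 3 →
          ¬ HasServedFibre 6 3 (fun X θ => θ ∈ secantAnchorSixfold C X) (secantServedClasses C) f W := by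
  intro hnone
  obtain ⟨𝒳, S, f, W, s₀, hf, h𝒳, hirr, haff, hsm, hdim, hab, hsec, hW, halg, hserved⟩ :=
    exists_servedConstantPencil_of_hasSecantCarrierWeilAnchor (hM 4 (by decide) le_rfl)
  exact hnone f hf h𝒳 hirr haff hsm hdim hab hsec W hW s₀ halg hserved

end ConstantPencil

/-! ## §3 The conditional half: inside regime 2, modulo the preprint and the displayed family supply -/

section RegimeTwo

variable {C : ChernCharacterBetti}

/-- **INSIDE REGIME 2, MODULO THE PREPRINT AND `SecantAnchorWeilPencilSupply`** (transport-free). The supplied exceptional cell-shaped pencil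
through the anchor `(Y, h)` carrying `γ` satisfies every binder of the cell `(6, 3)` of K-SR♭∃; its class `W` is fibrewise rational `(3,3)`,
ALGEBRAIC at the anchor fibre (`W| = γ` transported, `γ` algebraic by §1) and NOT algebraic-Lefschetz on every fibre (the supply's exceptional
member) — regime 2 —; and the anchor fibre is SERVED (`Θ| = h` and `W| = γ` transported; anchor and served memberships by the every-copy clause at
the copy `𝒳_{sₐ} ≅ Y`). [cite: vanGeemen1994HodgeAV, Thm. 4.11 and 5.3–5.5] [cite: Markman2025SecantWeil, Thm. 1.4.1, Cor. 4.0.4 and §1.5]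
[cite: Bloch1972Semiregularity, Remark (7.5)] -/
theorem exists_servedPencil_regimeTwo_of_hasSecantCarrierWeilAnchor_of_supply {d : ℕ} (hd0 : 0 < d)
    (hd : HasSecantCarrierWeilAnchor C (fun n X₀ I E => Summit.Ventures.HSemireg.gluableSigmaAdmissible n X₀ I E ∨
      Literature.AlgebraicGeometry.HodgeTheory.bfSingleAdmissible n X₀ I E) d)
    (hsup : SecantAnchorWeilPencilSupply) :
    ∃ (𝒳 S : SchemeOver ℂ) (f : 𝒳 ⟶ S) (W : complexBetti 𝒳 (2 * 3)) (s₀ : ComplexPoints S),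
      IsSmoothProjectiveFamily f 6 ∧ IsQuasiProjectiveOver 𝒳 ∧ IrreducibleSpace S.left ∧ IsAffine S.left ∧
      AlgebraicGeometry.Smooth S.hom ∧ topologicalKrullDim S.left = 1 ∧
      (∀ s : ComplexPoints S, ∃ A' : AbelianVariety ℂ, A'.dim = 6 ∧ Nonempty (A'.X ≅ fiberOver f s)) ∧
      (∃ e : S ⟶ 𝒳, e ≫ f = 𝟙 S) ∧
      (∀ s : ComplexPoints S, IsRationalClass (complexBetti.map (fiberι f s) (2 * 3) W) ∧
        IsOfHodgeType 6 (fiberOver f s) (2 * 3) 3 3 (complexBetti.map (fiberι f s) (2 * 3) W)) ∧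
      complexBetti.map (fiberι f s₀) (2 * 3) W ∈ algebraicClasses (fiberOver f s₀) 3 ∧
      (¬ ∀ s : ComplexPoints S,
        complexBetti.map (fiberι f s) (2 * 3) W ∈ algebraicClasses (fiberOver f s) 3 ∧
        complexBetti.map (fiberι f s) (2 * 3) W ∈ divisorClassesSpan (fiberOver f s) 6 3) ∧
      HasServedFibre 6 3 (fun X θ => θ ∈ secantAnchorSixfold C X) (secantServedClasses C) f W := by
  obtain ⟨P, Y, ψ₀, q, h, γ, hP, hY, hψ, hq, hpol, hhyp, hγQ, hγalg, hγoff, hγW, hcopy⟩ :=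
    exists_anchor_of_hasSecantCarrierWeilAnchor hd
  obtain ⟨𝒳, S, f, sₐ, e, Θ, W, hf, h𝒳, hirr, haff, hsm, hdim, hab, hsec, hΘQ, hΘH, hW, hΘ, hWa, hexc⟩ :=
    hsup d P Y ψ₀ q h γ hd0 hP hY hψ hq hpol hhyp hγQ hγoff hγW
  refine ⟨𝒳, S, f, W, sₐ, hf, h𝒳, hirr, haff, hsm, hdim, hab, hsec, hW, ?_, hexc, ?_⟩
  · rw [hWa]
    exact (mem_algebraicClasses_map_iff_of_iso e.symm).2 hγalg
  · refine ⟨sₐ, Θ, hΘQ, hΘH, ?_, ?_⟩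
    · rw [hΘ]
      exact (hcopy _ e.symm).1
    · rw [hΘ, hWa]
      exact (hcopy _ e.symm).2

/-- **THE PENCIL-LEVEL C2 WITNESS INSIDE THE CELL'S BINDERS** (the `¬ ∀`-form PART AA-c / AA-d ask for): modulo the preprint fact and the displayed
family supply, it is NOT the case that every smooth projective abelian-sixfold pencil whose class `W` is somewhere exceptional has NO served fibre
for the secant data — the through-anchor piece `ThroughSecantAnchor63 C` asserts a datum for a pencil IN the regime, and `Residual63 C` excludes it.
[cite: Markman2025SecantWeil, Thm. 1.4.1 and §1.5] [cite: vanGeemen1994HodgeAV, Thm. 4.11] [cite: Bloch1972Semiregularity, Remark (7.5)] -/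
theorem not_forall_not_hasServedFibre_63_secant_regimeTwo_of_markman_of_supply
    (hM : Markman2025_secantQuotientAnchor_twistedCarrier_sixfold C
      (fun n X₀ I E => Summit.Ventures.HSemireg.gluableSigmaAdmissible n X₀ I E ∨
        Literature.AlgebraicGeometry.HodgeTheory.bfSingleAdmissible n X₀ I E))
    (hsup : SecantAnchorWeilPencilSupply) :
    ¬ ∀ ⦃𝒳 S : SchemeOver ℂ⦄ (f : 𝒳 ⟶ S) (W : complexBetti 𝒳 (2 * 3)), IsSmoothProjectiveFamily f 6 →
      (∀ s : ComplexPoints S, ∃ A' : AbelianVariety ℂ, A'.dim = 6 ∧ Nonempty (A'.X ≅ fiberOver f s)) →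
      (¬ ∀ s : ComplexPoints S,
        complexBetti.map (fiberι f s) (2 * 3) W ∈ algebraicClasses (fiberOver f s) 3 ∧
        complexBetti.map (fiberι f s) (2 * 3) W ∈ divisorClassesSpan (fiberOver f s) 6 3) →
      ¬ HasServedFibre 6 3 (fun X θ => θ ∈ secantAnchorSixfold C X) (secantServedClasses C) f W := by
  intro hnone
  obtain ⟨𝒳, S, f, W, s₀, hf, -, -, -, -, -, hab, -, -, -, hexc, hserved⟩ :=
    exists_servedPencil_regimeTwo_of_hasSecantCarrierWeilAnchor_of_supply (by decide : 0 < 4) (hM 4 (by decide) le_rfl) hsup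
  exact hnone f W hf hab hexc hserved

/-- **The same with EVERY binder of the cell `LefAtExceptionalRegimeAt _ 6 3` displayed in the negated universal statement** (quasi-projective
total space, smooth irreducible affine base of Krull dimension one, abelian fibres, a section; `W` fibrewise rational `(3,3)`, algebraic at `s₀`,
not algebraic-Lefschetz everywhere): the residual `Residual63 C` genuinely excludes a pencil satisfying every hypothesis of the rung in regime 2.
[cite: Markman2025SecantWeil, Thm. 1.4.1 and §1.5] [cite: vanGeemen1994HodgeAV, Thm. 4.11] [cite: Bloch1972Semiregularity, Remark (7.5)] -/
theorem not_forall_cell_not_hasServedFibre_63_secant_of_markman_of_supply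
    (hM : Markman2025_secantQuotientAnchor_twistedCarrier_sixfold C
      (fun n X₀ I E => Summit.Ventures.HSemireg.gluableSigmaAdmissible n X₀ I E ∨
        Literature.AlgebraicGeometry.HodgeTheory.bfSingleAdmissible n X₀ I E))
    (hsup : SecantAnchorWeilPencilSupply) :
    ¬ ∀ ⦃𝒳 S : SchemeOver ℂ⦄ (f : 𝒳 ⟶ S), IsSmoothProjectiveFamily f 6 → IsQuasiProjectiveOver 𝒳 →
      IrreducibleSpace S.left → IsAffine S.left → AlgebraicGeometry.Smooth S.hom → topologicalKrullDim S.left = 1 →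
      (∀ s : ComplexPoints S, ∃ A' : AbelianVariety ℂ, A'.dim = 6 ∧ Nonempty (A'.X ≅ fiberOver f s)) →
      (∃ e : S ⟶ 𝒳, e ≫ f = 𝟙 S) →
      ∀ (W : complexBetti 𝒳 (2 * 3)),
        (∀ s : ComplexPoints S, IsRationalClass (complexBetti.map (fiberι f s) (2 * 3) W) ∧
          IsOfHodgeType 6 (fiberOver f s) (2 * 3) 3 3 (complexBetti.map (fiberι f s) (2 * 3) W)) →
        ∀ s₀ : ComplexPoints S,
          complexBetti.map (fiberι f s₀) (2 * 3) W ∈ algebraicClasses (fiberOver f s₀) 3 →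
          (¬ ∀ s : ComplexPoints S,
            complexBetti.map (fiberι f s) (2 * 3) W ∈ algebraicClasses (fiberOver f s) 3 ∧
            complexBetti.map (fiberι f s) (2 * 3) W ∈ divisorClassesSpan (fiberOver f s) 6 3) →
          ¬ HasServedFibre 6 3 (fun X θ => θ ∈ secantAnchorSixfold C X) (secantServedClasses C) f W := by
  intro hnone
  obtain ⟨𝒳, S, f, W, s₀, hf, h𝒳, hirr, haff, hsm, hdim, hab, hsec, hW, halg, hexc, hserved⟩ :=
    exists_servedPencil_regimeTwo_of_hasSecantCarrierWeilAnchor_of_supply (by decide : 0 < 4) (hM 4 (by decide) le_rfl) hsup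
  exact hnone f hf h𝒳 hirr haff hsm hdim hab hsec W hW s₀ halg hexc hserved

/-- **The anchor's served class lies on an exceptional cell-shaped pencil (the generic criterion's input) modulo the supply** — the `(6,3)` secant
instance of `VHCAbelianSchemesRoadPencilThrough`'s membership, for the record: `γ ∈ exceptionalPencilClassesThrough 6 3 Y.X h` at the anchor of
`HasSecantCarrierWeilAnchor`. [cite: vanGeemen1994HodgeAV, Thm. 4.11 and 5.3–5.5] -/
theorem exists_mem_exceptionalPencilClassesThrough_of_hasSecantCarrierWeilAnchor_of_supply {d : ℕ} (hd0 : 0 < d)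
    (hd : HasSecantCarrierWeilAnchor C (fun n X₀ I E => Summit.Ventures.HSemireg.gluableSigmaAdmissible n X₀ I E ∨
      Literature.AlgebraicGeometry.HodgeTheory.bfSingleAdmissible n X₀ I E) d)
    (hsup : SecantAnchorWeilPencilSupply) :
    ∃ (Y : AbelianVariety ℂ) (h : complexBetti Y.X 2) (γ : complexBetti Y.X (2 * 3)),
      Y.dim = 6 ∧ IsPolarizationClass 6 Y.X h ∧ IsRationalClass γ ∧ γ ∈ algebraicClasses Y.X 3 ∧ γ ∉ (ℂ ∙ cupPowTwo h 3) ∧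
      h ∈ secantAnchorSixfold C Y.X ∧ γ ∈ secantServedClasses C Y.X h ∧
      γ ∈ exceptionalPencilClassesThrough 6 3 Y.X h := by
  obtain ⟨P, Y, ψ₀, q, h, γ, hP, hY, hψ, hq, hpol, hhyp, hγQ, hγalg, hγoff, hγW, hcopy⟩ :=
    exists_anchor_of_hasSecantCarrierWeilAnchor hd
  have hid := hcopy Y.X (Iso.refl Y.X)
  have hid2 : complexBetti.map (Iso.refl Y.X).hom 2 h = h := by
    rw [Iso.refl_hom, complexBetti.map_id]; rfl
  have hid6 : complexBetti.map (Iso.refl Y.X).hom (2 * 3) γ = γ := by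
    rw [Iso.refl_hom, complexBetti.map_id]; rfl
  rw [hid2, hid6] at hid
  exact ⟨Y, h, γ, hY, hpol, hγQ, hγalg, hγoff, hid.1, hid.2, hsup d P Y ψ₀ q h γ hd0 hP hY hψ hq hpol hhyp hγQ hγoff hγW⟩

end RegimeTwo

end Summit.HodgeConjecture.HodgeConjecture.Ring2.SemiregularRepresentatives

end
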